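import Mathlib
import Summits.ValiantsHypothesis.ValiantsHypothesis.Theorems.KPlusLogSqLawTropicalBSingleGauge

/-!
# Route «KPlusLogSqLaw», crux `TropicalB` (stmt-ValiantsHypothesis-19771) — the single-gauge law is `K`-FREE on STATIC designs:
# a static dominant chain with `G` affine dual regimes has `n ≤ m(G·m − 1)`; one gauge ⇒ `n ≤ m(m − 1)`

HONEST FRAMING.  Helper file (cell `pub-symmetroid`, seat val-sym-trop-p5 g10, 2026-08-27) `--supports` the crux
`Summit.ValiantsHypothesis.ValiantsHypothesis.Theses.KPlusLogSqLaw.TropicalB` (item `stmt-ValiantsHypothesis-19771`), a corollary file of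
`…TropicalBSingleGauge` (p554764, the SINGLE-GAUGE LAW `n ≤ Σ_j (G·N_j − 1)`).  In a STATIC design (one present class per entry,
`TropicalCensus.IsStatic` — the crux's canonical dress by `tropicalB_iff_staticDiagonal`, i.e. plain parametric ASSIGNMENT, 2-D shadows of the
Birkhoff polytope) a column has at most `m` present incidences (`card_present_le_of_isStatic`), so the law loses its `K`:
`static_chain_le_of_gaugePieces` — **`n ≤ m·(G·m − 1)`** for a chain cut into `G` consecutive pieces each certified column-wise by its own affine
row gauge; `static_chain_le_of_singleGauge` — **`n ≤ m·(m − 1)`** with one gauge, for ANY number of slope classes.  Reading (located, not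
claimed): a 2-D shadow path of the Birkhoff polytope `B_m` with more than `G·m²` vertices needs more than `G` affine pieces of its optimal row
dual, whatever the slope matrix.  Nothing here bounds `TropicalB` for general chains, and nothing bears on `TropicalB` in its window,
`WeakLifting`, DoorA26 / DoorA34, `MatrixDescartes` (stmt-ValiantsHypothesis-18050) or VP ≠ VNP.
[folklore] LP duality; packaging of the cell.
-/

set_option linter.dupNamespace false
set_option autoImplicit false

namespace Summit.ValiantsHypothesis.ValiantsHypothesis.Theorems.KPlusLogSqLaw

open Summit.ValiantsHypothesis.ValiantsHypothesis.Theorems.MatrixDescartes.Negative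
open Summit.ValiantsHypothesis.ValiantsHypothesis.Theorems.LacunarySymmetroidMatrixDescartes
open Summit.ValiantsHypothesis.ValiantsHypothesis.Theorems.LacunarySymmetroidMatrixDescartes.TropicalCensus
open scoped BigOperators
open Finset

namespace SingleGauge

variable {m K : ℕ}

/-- in a static design every column has at most `m` present incidences (the row of an incidence determines its class). [folklore] -/
theorem card_present_le_of_isStatic (ε : Fin m → Fin m → Fin K → ℤ) (hst : IsStatic ε) (j : Fin m) :
    ((univ : Finset (Fin m × Fin K)).filter (fun il => ε il.1 j il.2 ≠ 0)).card ≤ m := by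
  classical
  calc ((univ : Finset (Fin m × Fin K)).filter (fun il => ε il.1 j il.2 ≠ 0)).card
      ≤ (univ : Finset (Fin m)).card := by
        refine card_le_card_of_injOn (fun il => il.1) (fun il _ => mem_univ _) ?_
        intro a ha b hb hab
        simp only [coe_filter, mem_univ, true_and, Set.mem_setOf_eq] at ha hb
        have h1 : a.1 = b.1 := hab
        have h2 : a.2 = b.2 := hst a.1 j a.2 b.2 ha (h1 ▸ hb)
        exact Prod.ext h1 h2
    _ = m := by rw [card_univ, Fintype.card_fin]

/-- **Static dual regimes, `K`-free.**  A dominant chain of a STATIC design cut into `G` consecutive pieces, each certified column-wise by its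
own affine row gauge, has `n ≤ m·(G·m − 1)`. [packaging of the cell] -/
theorem static_chain_le_of_gaugePieces (d : Fin K → ℕ) (v ε : Fin m → Fin m → Fin K → ℤ) (hst : IsStatic ε) {G : ℕ}
    (α β : Fin G → Fin m → ℚ) {n : ℕ} (θ : Fin (n + 1) → ℤ) (hθ : StrictMono θ)
    (p : Fin (n + 1) → Equiv.Perm (Fin m) × (Fin m → Fin K))
    (hdom : ∀ k, IsDominant d v ε (θ k) (p k)) (hne : ∀ k : Fin n, p k.castSucc ≠ p k.succ)
    (g : Fin (n + 1) → Fin G) (hg : Monotone g)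
    (hcert : ∀ (k : Fin (n + 1)) (j i : Fin m) (l : Fin K), ε i j l ≠ 0 →
      ((θ k : ℚ) * (d l : ℚ) - (v i j l : ℚ)) - (α (g k) i * (θ k : ℚ) + β (g k) i) ≤
        ((θ k : ℚ) * (d ((p k).2 j) : ℚ) - (v ((p k).1 j) j ((p k).2 j) : ℚ)) -
          (α (g k) ((p k).1 j) * (θ k : ℚ) + β (g k) ((p k).1 j))) :
    n ≤ m * (G * m - 1) := by
  classical
  refine (chain_le_sum_of_gaugePieces d v ε α β θ hθ p hdom hne g hg hcert).trans ?_
  have hb : ∀ j : Fin m, G * ((univ : Finset (Fin m × Fin K)).filter (fun il => ε il.1 j il.2 ≠ 0)).card - 1 ≤ G * m - 1 :=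
    fun j => Nat.sub_le_sub_right (Nat.mul_le_mul_left G (card_present_le_of_isStatic ε hst j)) 1
  calc ∑ j : Fin m, (G * ((univ : Finset (Fin m × Fin K)).filter (fun il => ε il.1 j il.2 ≠ 0)).card - 1)
      ≤ (univ : Finset (Fin m)).card • (G * m - 1) := sum_le_card_nsmul _ _ _ fun j _ => hb j
    _ = m * (G * m - 1) := by rw [card_univ, Fintype.card_fin, smul_eq_mul]

/-- **Static single-gauge law, `K`-free.**  A dominant chain of a STATIC design certified throughout by ONE affine row gauge has
`n ≤ m·(m − 1)` — for any number of slope classes. [packaging of the cell] -/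
theorem static_chain_le_of_singleGauge (d : Fin K → ℕ) (v ε : Fin m → Fin m → Fin K → ℤ) (hst : IsStatic ε)
    (α β : Fin m → ℚ) {n : ℕ} (θ : Fin (n + 1) → ℤ) (hθ : StrictMono θ)
    (p : Fin (n + 1) → Equiv.Perm (Fin m) × (Fin m → Fin K))
    (hdom : ∀ k, IsDominant d v ε (θ k) (p k)) (hne : ∀ k : Fin n, p k.castSucc ≠ p k.succ)
    (hcert : ∀ (k : Fin (n + 1)) (j i : Fin m) (l : Fin K), ε i j l ≠ 0 →
      ((θ k : ℚ) * (d l : ℚ) - (v i j l : ℚ)) - (α i * (θ k : ℚ) + β i) ≤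
        ((θ k : ℚ) * (d ((p k).2 j) : ℚ) - (v ((p k).1 j) j ((p k).2 j) : ℚ)) - (α ((p k).1 j) * (θ k : ℚ) + β ((p k).1 j))) :
    n ≤ m * (m - 1) := by
  have h := static_chain_le_of_gaugePieces d v ε hst (fun _ : Fin 1 => α) (fun _ => β) θ hθ p hdom hne (fun _ => 0)
    (fun _ _ _ => le_rfl) hcert
  simpa only [one_mul] using h

end SingleGauge

end Summit.ValiantsHypothesis.ValiantsHypothesis.Theorems.KPlusLogSqLaw
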